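import Literature.Probability.Percolation.CornerPercolation
import Literature.Probability.Percolation.RSWLemma
import Summits.CriticalPhenomena.CardyFormulaZ2.Theorems.CardySelfDualSegmentUniformBoxCrossingStubJoin
import HarnessLib

/-!
# Stub `stub_brChain` (crux stmt-CriticalPhenomena-5476 `UniformBoxCrossing`, line `Sketch`):
# closed pieces and the exact shape of what is missing

Bollobás–Riordan, *Percolation on self-dual polygon configurations* (2010, arXiv:1001.4674),
§5.1 (Lemma 5.6 and the proof of Theorem 5.3) for the corner models `M_t = cornerPercolation t`.

## What this file proves (sorry-free)

* `apply_ge_of_darts` — walk bookkeeping (mirror of `apply_le_of_darts`).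
* `join_of_tbCrossing` — **hard-way crossing ⇒ JOIN, deterministically**: on lattice
  configurations, an open horizontal crossing `a₁ ↔ b₁` of `S₁ = [0,n]²`, an open horizontal
  crossing `a₂ + (0,k) ↔ b₂ + (0,k)` of `S₂ = S₁ + (0,k)` and an open vertical crossing of
  `R = [0,n] × [0,n+k]` give `a₁ ↔ a₂ + (0,k)` inside `R` (the vertical crossing, cut at its first
  visit to height `n` and at its last visit to height `k`, crosses `S₁` bottom-to-top and `S₂`
  bottom-to-top, so it meets both horizontal crossings — `exists_mem_support_of_crossing`).
* `quarter_le_real_join_of_tbCrossing` — Harris–FKG for `M_t` and `M_t(H(square)) ≥ 1/2`: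
  `M_t(TB([0,n] × [0,n+k])) ≥ c ⇒ M_t(JOIN(n,k)) ≥ c/4`.
* `stub_brChain_of_tbBound` — hence **the registered conclusion of `stub_brChain` follows from a
  uniform hard-way bound** `∃ c K n₀, ∀ t, ∀ n ≥ n₀, ∃ k ∈ [n/K, n], M_t(TB([0,n]×[0,n+k])) ≥ c`,
  which is literally Bollobás–Riordan's Theorem 5.3 in its weakest form `v(n, (1+ε)n) ≥ c`
  (before Lemma 5.4). Together with the landed `stub_join` (JOIN ⇒ hard way) the JOIN item and the
  hard-way item are interchangeable; a future proof of the chaining engine may target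
  `tbCrossing n (n + k)` directly and finish with `stub_brChain_of_tbBound`.

Sibling files (all sorry-free, axioms ⊆ {propext, Classical.choice, Quot.sound}, Literature
style, dry-run as `kind=definition` since they introduce `def`s):

* `work/stubs/stub_brChain_splice.lean` → `Literature/Probability/LatticeModels/ProdBernoulliSplice.lean`:
  the measure-theoretic engine — `IsStoppingSet` (+ `.of_comp`, `.union`, `.const`), `splice`,
  `ext_of_localCylinder`, **`prodBernoulli_prod_map_splice`** (the splice of `ω₁` with any fresh
  source along a stopping set has law `μ`), **`prodBernoulli_prod_prod_map_spliceShift`** (B–R's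
  literal `f_ALG(ω₁, ω₂, X)`).
* `work/stubs/stub_brChain_energy.lean` → `Literature/Probability/LatticeModels/ProdBernoulliRecolour.lean`:
  `setOn`, `prodBernoulli_inter_localCylinder_eq_mul_preimage_setOn` (finite energy as an
  identity), `prodBernoulli_real_localCylinder`, **`mul_prod_le_of_reconstructible`** (B–R §5.2:
  "we know which two faces were recoloured, though not how" ⇒ `δ · P(E) ≤ P(J)`).
* `work/stubs/stub_brChain_chain.lean` → `Literature/Probability/Percolation/TranslateChaining.lean`:
  item 4 below in full — **`exists_translates_linking`** (the colouring of `R₀` / pigeonhole,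
  over any additive group) and **`exists_translates_linking_strip`** (the strip `[0,n] × ℤ` with
  B–R's rounding made explicit: `(r+1)² ≤ I · #Xs + (I-1) · #G`).
* `work/stubs/stub_brChain_interface.lean` → `Literature/Probability/Percolation/LowestCrossingInterface.lean`
  (kind=proof, no defs): item 2(b) below at the origin square — for `π` an `IsSquareCrossing` with
  boundary edges of an achieved `D₀ = dualBelow j ω₀` and `W = walkWinding (extendRight π 0)`:
  **`walkWinding_ext_of_mem`** (`W = -1` on `D₀`), **`walkWinding_ext_eq_of_mem_dualEdge`** (off
  `π` the four faces around a vertex wind equally), **`mem_support_of_winding`** /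
  **`mem_support_of_face_mem`** (THE INTERFACE LEMMA: a vertex with a `W = -1` face and an edge
  whose two faces have `W ≠ -1` lies on `π`), `not_mem_of_winding_ne`, and item 2(c):
  `exists_subwalk_inter_free` (the minimal sub-walk from `A` to `B`).

Gate dry-runs (2026-08-16, `--supports stmt-CriticalPhenomena-5476`, nothing proposed for real):
`ProdBernoulliSplice.lean` and `ProdBernoulliRecolour.lean` (kind=definition — they must be, they
introduce `IsStoppingSet`/`splice`/`exactCylinders` and `setOn`): would-be verdict QUEUED [stage
route] = all automatic stages pass, human/agent review as for every definition file;
`TranslateChaining.lean` (made def-free, kind=proof): would-be verdict ACCEPT;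
`LowestCrossingInterface.lean` (kind=proof): ACCEPT; this file as
`…UniformBoxCrossingStubBRChainPart1.lean` (kind=proof, --supports): ACCEPT. The exact commands are the
`ledger propose --kind {definition|proof} --target <target above> --file work/stubs/<file> --supports
stmt-CriticalPhenomena-5476` of the dry-runs, without `--dry-run`.

## Why `stub_brChain` itself is not closed here (stub-blocked), and the corrected blueprint

The registered hypothesis `hNS` controls the abscissae of the END-points of an open bottom–top
path of the square, not of its first/last visits to the top/bottom rows. Every exploration-free
way of using such paths as "links" between independently refreshed regions needs the link to
cross a straight seam at a prescribed vertex, which costs a factor `n` (point-to-point), or needs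
truncated endpoints (not controlled by `hNS`). Hence B–R's structure is forced: explore the lowest
crossing `P₁ = LH(S₁)` from below and the highest crossing `P₂ = UH(S₂)` from above (both OPEN, hence
absorbing), refresh the gap from a translate `ω₂ + X`, and place one translate of the non-slant
path across the gap (Lemma 5.6 makes the gap small so that a single link suffices). Missing tree
infrastructure, with the signatures a proof needs (all over `Literature.Probability.Percolation`):

1. `dualAbove` / highest crossing, and both explorations for VERTICALLY TRANSLATED squares
   `S = [0,j]² + (0, y₀)` (the only translates B–R need). Cheapest design: transport POINTWISE
   predicates rather than re-prove — `dualBelowAt y₀ j ω := (dualBelow j (ω.relabel (sym2Equiv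
   (Site.shift ![0, -y₀])))).map (+ (0, y₀))`, and for the highest crossing
   `dualAbove j ω := (dualBelow j (ω.relabel (sym2Equiv (reflY j).toEquiv))).image ρ*` with the face reflection
   `ρ* g = (g₀, j - 1 - g₁)` (`reflY` of `RSWLemma.lean`, reflection in the line `x₁ = j/2`, maps
   `[0,j]²` to itself and swaps top/bottom; `ρ* = reflY (j - 1)`); the commutation lemmas
   `dualEdge_map_reflY : dualEdge (Sym2.map (reflY c) e) = Sym2.map (reflY (c-1)) (dualEdge e)` and
   `dualConfig_relabel_reflY` are DONE in `stub_brChain_interface.lean` (shifts: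
   `dualConfig_relabel_shift`, `FourArmGarbanDocking.lean`); still needed: `squareEdges (ρ* g) =
   ρ '' squareEdges g`, the images of `dualRectangle`/`dualTopSide`/`dualBottomSide`; then
   `determinedBy_dualAbove_eq`, `mem_of_isBdryEdge` (above), `exists_bdryWalk` (above: an open LR
   crossing of boundary edges), and the interface lemma of `stub_brChain_interface.lean` all
   transfer along the graph isomorphism (`Walk.map`) and pointwise (≈ 500 lines).
2. Regions, via WINDING NUMBERS of the boundary walks (not via vertices of `D`-faces: the open
   "bubbles" enclosed below the lowest crossing are not dual-joined to the bottom, yet belong to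
   B–R's region `A`). Let `π₁` be a PATH extracted (`Walk.toPath`) from `exists_bdryWalkAt` for
   `D₁ = dualBelowAt`, `π̂₁ = extendRight π₁ _` (`PlanarDuality.lean`), `W₁ = walkWinding π̂₁`.
   `belowRegion := π₁.support ∪ {v | some face around v has W₁ = -1}` (plus the half-strip
   below `S₁`); `aboveRegion` for `S₂` symmetrically with the highest crossing `π₂` and
   `W₂ = 0` on the faces of `D₂` (these are dual-joined to the top faces without crossing the
   open edges of `π₂`; cf. `walkWinding_symExt_of_mem` for `W₁ = -1` on `D₁`). Needed facts:
   (a) corners examined for `D₁` have all their vertices in `belowRegion` (`W₁ = -1` on `D₁`);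
   (b) **interface lemma, winding form**: DONE at the origin square
   (`stub_brChain_interface.lean`): if `a ∈ belowRegion`, `u ∉ belowRegion`, `u ∼ a`, then
   `a ∈ π₁.support`, and the exit edge bounds no `D₁`-face; remains: transport to translated
   squares and the mirror statement for the highest crossing (item 1);
   (c) DONE (`exists_subwalk_inter_free` in `stub_brChain_interface.lean`): a
   walk from `A` to `B` has a sub-walk from some `a ∈ A` to some `b ∈ B` whose steps start
   outside `B` and end outside `A` (its darts among the original ones);
   (d) `#`-bookkeeping of the gap `G = (strip ∩ rows of S₁ ∪ S₂) \ (A ∪ B)` as a `Finset`.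
3. Lemma 5.6 (small gap): for `N = 2⌈2/ε⌉` squares `S_i = S₁ + (0, i s)`: `¬ J(S_i,S_{i+1})` and
   `H(S_i)` for all `i` ⇒ some `i` has `#G(S_i, S_{i+1}) ≤ ε n²`. With winding-defined regions
   the needed planar input is: (K) `H(S_{i+1}) ∧ H(S_{i+2}) ∧ ¬J(S_{i+1},S_{i+2})` ⇒ every strip
   vertex in the relevant rows lies in `aboveRegion(S_{i+1}) ∪ belowRegion(S_{i+2})` (else the
   column through such a vertex meets `π⁺_{i+1}` above it and `π⁻_{i+2}` below it; if
   `π⁻_{i+2} ⊆ S_{i+1}` it is itself a joined pair of crossings, otherwise it has a vertex above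
   all of `π⁺_{i+1}` where `walkWinding π̂⁺_{i+1} = 0`, constant along `π⁻_{i+2}` if the two
   paths are disjoint — contradiction with the crossing of the column); then the gaps
   `G(S_i,S_{i+1})`, `i` even, are pairwise disjoint subsets of `[0,n] × [0, 2n]`, and pigeonhole.
   (≈ 800–1000 lines: the hard half is every "`W ≠ -1` ⇒ geometric position" step, for which only
   column walks to `±∞` are available, `walkWinding_eq_zero_of_le/ge`.)
4. Chaining geometry (B–R pp. 23–24): DONE (`stub_brChain_chain.lean`), up to the final choice
   of constants `x₀ = ⌈β₁n⌉`, `r = ⌊γn⌋`, `I = ⌈(y_B + r + 1)/a⌉` satisfying the four endpoint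
   inequalities of `exists_translates_linking_strip` from `η ≥ 3β₁ + 3γ` (real arithmetic).
5. JUNCTION (corrects the line card). Examine WHOLE CORNERS: `𝒮(ω₁)` := all bits of the corners
   `z` having an edge that bounds a face of `D₁` or of `D₂` (B–R's "zone of influence" `Z(I_i)`;
   stopping set by `determinedBy_dualBelowAt_eq` and `IsStoppingSet.of_comp`/`.union`). Take the
   minimal sub-walk of the link `P + X` from `A` to `B` (2(c)): its steps start outside `B` and end
   outside `A`, so by 2(a) and its mirror every step other than the first and the last has an
   UNEXAMINED corner, read from `ω₂ + X`, where it is a step of `P`: open. Let `a ∈ A` be its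
   first vertex and `{a, u}` its first edge, with corner `z = min(a, u)`.
   * `u = a - e₀` or `a - e₁`: the corner `u` has no edge bounding a `D₁`-face (else `u ∈ A` by
     2(a)), so its bits are read from `ω₂ + X`, where the edge is an edge of `P`: OPEN.
   * `u = a + e₀` or `a + e₁`, corner `a`. Either corner `a ∉ 𝒮` (then fresh, open as above), or
     corner `a ∈ 𝒮` is FULLY examined — and then the exit edge may be examined-and-CLOSED: this
     happens at every overhang of `P₁` (`NW_a ∈ D₁`, `NE_a, SE_a ∉ D₁`, `E_a` closed, exit to the
     east), with conditional probability `t/2`, so the card's "examined-closed impossible" is false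
     and a third source `ω₃` does not help. Fix (B–R §5.2): recolour corner `a` of `ω₁` to
     `(c, d) = (1, 0)` (both edges open; probability `(1/2)(1 - t/2) ≥ 1/4` for all `t`; opening
     `E_a` alone while keeping `N_a` would need `(1,1)`, of probability `t/4 → 0`). Both faces of
     the exit edge lie outside `D₁` (else `u ∈ A`); the sibling edge of the corner is either
     already open or separates two faces outside `D₁` or a face outside `S₁*` (case check: a
     closed sibling edge next to a `D₁`-face would put the exit edge's face into `D₁`), so `D₁`,
     hence `𝒮`, `P₁`, `A` are unchanged, and `a` is recomputable from `(ω₁', ω₂, X)` as the exit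
     vertex of `P + X` from `A`:
     the recolouring map is `≤ 4`-to-one with density ratio `≤ 1`, whence
     `P(image) ≥ P(E)/4` (`mul_prod_le_of_reconstructible` with `κ' = κ`: make `π₁` a FUNCTION
     of `D₁` — `Classical.choose` on `exists_bdryWalkAt` — so that `A`, the exit vertex and the
     recoloured bits are functions of `(D₁(ω₁), D₂(ω₁), ω₂, X)`, all unchanged by the
     recolouring; put `A ∩ B = ∅` into `G_ε` so that no face at a junction corner of `A` lies in
     `D₂`). Same at the `B` end (entry into `b ∈ P₂` from `b + e₀`/`b + e₁`: corner `b`, trap iff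
     `NW_b ∈ D₂` overhang). Net: `M_t(J ∩ G_ε) ≥ (1/16) (γ²α/400) c₃ c₂`, two sources only.
6. Assembly: `X` uniform on `[-5n, 5n-1]²`, `prodBernoulli_prod_prod_map_spliceShift` with
   `σ X = (Equiv.prodCongr (Site.shift X) (Equiv.refl (Fin 2))).symm` (= `vertexReindex`,
   `vertexReindex_eq_image`; `cornerParam`-preserving by `rfl`, cf.
   `prodBernoulli_cornerParam_map_vertexReindex`), `relabel_shift_cornerConfig` to read the shift
   on bond configurations, `mul_prod_le_of_reconstructible` for item 5 with `δ = (1/4)²`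
   (`prodBernoulli_real_localCylinder` on the ≤ 4 recoloured bits), the deterministic bound
   `#{X ∈ C'_i} ≥ γ²α n²/4` of item 4 integrated over `(ω₁, ω₂)` (`Measure.prod_apply`), and the
   pull-back through `cornerConfig` (`cornerPercolation_def`, `cornerPercolation_real_apply`).

Total estimate for items 1, 2, 3, 5, 6: 2.5–3.5 kLoC beyond the general lemmas delivered here.
-/

noncomputable section

namespace Summit.CriticalPhenomena.CardyFormulaZ2.Cruxes.UniformBoxCrossing.NonSlantLine

open MeasureTheory Literature.Probability.Percolation Literature.Probability.LatticeModels

/-- A lattice walk starting at height `≥ c` none of whose step sources lies at height `c` stays at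
height `≥ c` (mirror image of `apply_le_of_darts`). [folklore] -/
theorem apply_ge_of_darts {x y : Site 2} (p : (zdGraph 2).Walk x y) (i : Fin 2) (c : ℤ)
    (hx : c ≤ x i) (h : ∀ d ∈ p.darts, d.fst i ≠ c) : ∀ z ∈ p.support, c ≤ z i := by
  induction p with
  | nil => intro z hz; rw [SimpleGraph.Walk.support_nil, List.mem_singleton] at hz; rw [hz]; exact hx
  | cons hadj p ih =>
    rename_i x w y
    have hxc : x i ≠ c := h ⟨(x, w), hadj⟩ (by simp)
    have hw : c ≤ w i := by have := (zdGraph_adj_apply_le hadj i).2; omega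
    intro z hz
    rw [SimpleGraph.Walk.support_cons, List.mem_cons] at hz
    rcases hz with rfl | hz
    · exact hx
    · exact ih hw (fun d hd => h d (by simp [hd])) z hz

/-- **A hard-way vertical crossing joins the horizontal crossings of the two stacked squares**
(converse direction of Bollobás–Riordan 2010, Lemma 5.5, deterministic content). Let
`S₁ = [0, n]²`, `S₂ = S₁ + (0, k)`, `R = S₁ ∪ S₂ = [0, n] × [0, n + k]`, `ω` a lattice configuration.
If `a₁ ↔ b₁` is an open horizontal crossing of `S₁`, `a₂ + (0,k) ↔ b₂ + (0,k)` one of `S₂`, and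
`R` has an open vertical crossing `Q`, then `a₁ ↔ a₂ + (0, k)` inside `R`: the initial segment of
`Q` up to its first visit to height `n` crosses `S₁` from bottom to top, so it meets the first
horizontal crossing (`exists_mem_support_of_crossing`); the final segment of `Q` after its last
visit to height `k` crosses `S₂` from bottom to top, so it meets the second.
[cite: BollobasRiordan2010, §5.1 Lemma 5.5] -/
theorem join_of_tbCrossing {n k : ℕ} {ω : BondConfig (Site 2)} (hω : ω ⊆ (zdGraph 2).edgeSet)
    {a₁ b₁ a₂ b₂ : Site 2} (ha₁ : a₁ ∈ leftSide n n) (hb₁ : b₁ ∈ rightSide n n)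
    (ha₂ : a₂ ∈ leftSide n n) (hb₂ : b₂ ∈ rightSide n n)
    (h₁ : ω ∈ openConnIn (↑(rectangle n n)) a₁ b₁)
    (h₂ : ω ∈ openConnIn ((· + ![0, (k : ℤ)]) '' ↑(rectangle n n)) (a₂ + ![0, (k : ℤ)])
      (b₂ + ![0, (k : ℤ)]))
    (hV : ω ∈ tbCrossing n (n + k)) :
    ω ∈ openConnIn (↑(rectangle n (n + k))) a₁ (a₂ + ![0, (k : ℤ)]) := by
  classical
  set v : Site 2 := ![0, (k : ℤ)] with hv
  have hv0 : v 0 = 0 := rfl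
  have hv1 : v 1 = k := rfl
  set S₁ : Set (Site 2) := ↑(rectangle n n) with hS₁
  set S₂ : Set (Site 2) := (· + v) '' ↑(rectangle n n) with hS₂
  set Big : Set (Site 2) := ↑(rectangle n (n + k)) with hBig
  have hmemS₁ : ∀ z : Site 2, z ∈ S₁ ↔ 0 ≤ z 0 ∧ z 0 ≤ n ∧ 0 ≤ z 1 ∧ z 1 ≤ n := fun z => by
    rw [hS₁, Finset.mem_coe, mem_rectangle_iff]
  have hmemS₂ : ∀ z : Site 2, z ∈ S₂ ↔ 0 ≤ z 0 ∧ z 0 ≤ n ∧ (k : ℤ) ≤ z 1 ∧ z 1 ≤ n + k :=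
    fun z => by
    rw [hS₂, mem_image_add_rectangle, hv0, hv1]
    constructor <;> intro h <;> omega
  have hmemBig : ∀ z : Site 2, z ∈ Big ↔ 0 ≤ z 0 ∧ z 0 ≤ n ∧ 0 ≤ z 1 ∧ z 1 ≤ n + k := fun z => by
    rw [hBig, Finset.mem_coe, mem_rectangle_iff]
    push_cast
    exact Iff.rfl
  have hS₁Big : S₁ ⊆ Big := fun z hz => by
    rw [hmemS₁] at hz
    rw [hmemBig]
    omega
  have hS₂Big : S₂ ⊆ Big := fun z hz => by
    rw [hmemS₂] at hz
    rw [hmemBig]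
    omega
  simp only [leftSide, rightSide, Finset.mem_filter, mem_rectangle_iff] at ha₁ hb₁ ha₂ hb₂
  -- the vertical crossing `W : p ⟶ q` of the big rectangle
  obtain ⟨p, hp, q, hq, hpq⟩ := hV
  simp only [Finset.mem_coe, bottomSide, topSide, Finset.mem_filter, mem_rectangle_iff] at hp hq
  obtain ⟨W, hWS, hWω⟩ := exists_walk_of_mem_openConnIn hω hpq
  have hWBig : ∀ z ∈ W.support, 0 ≤ z 0 ∧ z 0 ≤ n ∧ 0 ≤ z 1 ∧ z 1 ≤ n + k := fun z hz =>
    (hmemBig z).1 (hWS z hz)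
  -- its initial segment up to the first visit to height `n` crosses `S₁` from bottom to top
  obtain ⟨u, hu, W₁, hW₁s, -, hW₁d⟩ := exists_prefix_first_mem (O := {z : Site 2 | z 1 = n}) W
    (exists_mem_support_apply_eq W 1 n (by rw [hp.2]; exact_mod_cast Nat.zero_le n)
      (by rw [hq.2]; push_cast; omega))
  have hu1 : u 1 = n := hu
  have hW₁le : ∀ z ∈ W₁.support, z 1 ≤ n :=
    apply_le_of_darts W₁ 1 n (by rw [hp.2]; exact_mod_cast Nat.zero_le n) fun d hd => hW₁d d hd
  have hW₁S₁ : ∀ z ∈ W₁.support, 0 ≤ z 0 ∧ z 0 ≤ n ∧ 0 ≤ z 1 ∧ z 1 ≤ n := fun z hz => by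
    have h := hWBig z (hW₁s z hz)
    exact ⟨h.1, h.2.1, h.2.2.1, hW₁le z hz⟩
  obtain ⟨P₁, hP₁S, hP₁ω⟩ := exists_walk_of_mem_openConnIn hω h₁
  obtain ⟨w₁, hw₁P, hw₁W⟩ := exists_mem_support_of_crossing (L := 0) (R := n) (B := 0) (T := n)
    P₁ W₁ (fun z hz => (hmemS₁ z).1 (hP₁S z hz)) hW₁S₁ ha₁.2 hb₁.2 hp.2 hu1
  -- its final segment after the last visit to height `k` crosses `S₂` from bottom to top
  obtain ⟨z₀, hz₀, hz₀k⟩ := exists_mem_support_apply_eq W 1 k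
    (by rw [hp.2]; exact_mod_cast Nat.zero_le k) (by rw [hq.2]; push_cast; omega)
  obtain ⟨u', hu', W₂, hW₂s, -, hW₂d⟩ := exists_prefix_first_mem (O := {z : Site 2 | z 1 = k})
    W.reverse ⟨z₀, by rw [SimpleGraph.Walk.support_reverse, List.mem_reverse]; exact hz₀, hz₀k⟩
  have hu'1 : u' 1 = k := hu'
  have hW₂ge : ∀ z ∈ W₂.support, (k : ℤ) ≤ z 1 :=
    apply_ge_of_darts W₂ 1 k (by rw [hq.2]; push_cast; omega) fun d hd => hW₂d d hd
  have hW₂S₂ : ∀ z ∈ W₂.reverse.support, 0 ≤ z 0 ∧ z 0 ≤ n ∧ (k : ℤ) ≤ z 1 ∧ z 1 ≤ n + k := by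
    intro z hz
    rw [SimpleGraph.Walk.support_reverse, List.mem_reverse] at hz
    have hzW : z ∈ W.support := by
      have := hW₂s z hz
      rwa [SimpleGraph.Walk.support_reverse, List.mem_reverse] at this
    have h := hWBig z hzW
    exact ⟨h.1, h.2.1, hW₂ge z hz, h.2.2.2⟩
  obtain ⟨P₂, hP₂S, hP₂ω⟩ := exists_walk_of_mem_openConnIn hω h₂
  obtain ⟨w₂, hw₂P, hw₂W⟩ := exists_mem_support_of_crossing (L := 0) (R := n) (B := (k : ℤ))
    (T := n + k) P₂ W₂.reverse (fun z hz => (hmemS₂ z).1 (hP₂S z hz)) hW₂S₂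
    (by rw [Pi.add_apply, ha₂.2, hv0, add_zero]) (by rw [Pi.add_apply, hb₂.2, hv0, add_zero]) hu'1
    (by rw [hq.2]; push_cast; ring)
  -- `w₁` and `w₂` lie on `W`, an open walk inside the big rectangle
  have hw₁Wfull : w₁ ∈ W.support := hW₁s w₁ hw₁W
  have hw₂Wfull : w₂ ∈ W.support := by
    have := hW₂s w₂ (by rw [SimpleGraph.Walk.support_reverse, List.mem_reverse] at hw₂W; exact hw₂W)
    rwa [SimpleGraph.Walk.support_reverse, List.mem_reverse] at this
  -- assemble `a₁ ↔ w₁ ↔ p ↔ w₂ ↔ a₂ + v` inside the big rectangle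
  have c₁ : ω ∈ openConnIn Big a₁ w₁ :=
    openConnIn_mono hS₁Big _ _ (mem_openConnIn_of_mem_support P₁ hP₁S hP₁ω hw₁P)
  have c₂ : ω ∈ openConnIn Big w₁ p := by
    rw [openConnIn_comm]
    exact mem_openConnIn_of_mem_support W hWS hWω hw₁Wfull
  have c₃ : ω ∈ openConnIn Big p w₂ := mem_openConnIn_of_mem_support W hWS hWω hw₂Wfull
  have c₄ : ω ∈ openConnIn Big w₂ (a₂ + v) := by
    refine openConnIn_mono hS₂Big _ _ ?_
    rw [openConnIn_comm]
    exact mem_openConnIn_of_mem_support P₂ hP₂S hP₂ω hw₂P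
  exact PlanarDuality.openConnIn_trans (PlanarDuality.openConnIn_trans
    (PlanarDuality.openConnIn_trans c₁ c₂) c₃) c₄

/-- Squares are crossed horizontally with probability at least `1/2` under every `M_t`:
`1/2 = M_t(LR([0, n+1] × [0, n])) ≤ M_t(LR([0, n]²))`. [folklore] -/
theorem cornerPercolation_half_le_real_lrCrossing_self (t : unitInterval) (n : ℕ) :
    1 / 2 ≤ (cornerPercolation t).real (lrCrossing n n) := by
  rw [← cornerPercolation_real_lrCrossing_succ_self t n]
  exact cornerPercolation_real_lrCrossing_anti_left t (Nat.le_succ n) n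

/-- **Hard-way crossing ⇒ JOIN with probability `≥ c/4`** (converse of Bollobás–Riordan 2010,
Lemma 5.5, for `M_t`): if `M_t(TB([0, n] × [0, n + k])) ≥ c` then the JOIN event of the two
stacked `n`-squares `S₁ = [0,n]²`, `S₂ = S₁ + (0,k)` (open horizontal crossings `a₁ ↔ b₁` of `S₁`
and `a₂ + (0,k) ↔ b₂ + (0,k)` of `S₂` with `a₁ ↔ a₂ + (0,k)` inside `S₁ ∪ S₂`) has
`M_t`-probability `≥ c/4`: Harris–FKG for `M_t` (`cornerPercolation_real_inter_ge`) applied to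
the three increasing events `TB(R)`, `H(S₁)`, `H(S₂)`, squares being crossed with probability
`≥ 1/2`, and `join_of_tbCrossing` on the `M_t`-sure set of lattice configurations.
[cite: BollobasRiordan2010, §5.1 Lemma 5.5] -/
theorem quarter_le_real_join_of_tbCrossing (t : unitInterval) (n k : ℕ) {c : ℝ}
    (hc : c ≤ (cornerPercolation t).real (tbCrossing n (n + k))) :
    c / 4 ≤ (cornerPercolation t).real {ω | ∃ a₁ ∈ leftSide n n, ∃ b₁ ∈ rightSide n n,
          ∃ a₂ ∈ leftSide n n, ∃ b₂ ∈ rightSide n n,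
            ω ∈ openConnIn (↑(rectangle n n)) a₁ b₁ ∧
            ω ∈ openConnIn ((· + ![0, (k : ℤ)]) '' ↑(rectangle n n)) (a₂ + ![0, (k : ℤ)])
              (b₂ + ![0, (k : ℤ)]) ∧
            ω ∈ openConnIn (↑(rectangle n (n + k))) a₁ (a₂ + ![0, (k : ℤ)])} := by
  set V := tbCrossing n (n + k) with hVdef
  set H₁ := lrCrossing n n with hH₁def
  set H₂ := openCrossing ((· + ![0, (k : ℤ)]) '' (↑(rectangle n n) : Set (Site 2)))
    ((· + ![0, (k : ℤ)]) '' ↑(leftSide n n)) ((· + ![0, (k : ℤ)]) '' ↑(rightSide n n)) with hH₂def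
  have hPH₂ : (cornerPercolation t).real H₂ = (cornerPercolation t).real (lrCrossing n n) := by
    rw [hH₂def, cornerPercolation_real_openCrossing_shift]
    rfl
  have hH₁ : 1 / 2 ≤ (cornerPercolation t).real H₁ := cornerPercolation_half_le_real_lrCrossing_self t n
  have hH₂ : 1 / 2 ≤ (cornerPercolation t).real H₂ :=
    hPH₂ ▸ cornerPercolation_half_le_real_lrCrossing_self t n
  have hupV : IsUpperSet V := isUpperSet_tbCrossing n (n + k)
  have hupH₁ : IsUpperSet H₁ := isUpperSet_lrCrossing n n
  have hupH₂ : IsUpperSet H₂ := isUpperSet_openCrossing _ _ _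
  have hmsV : MeasurableSet V := measurableSet_tbCrossing n (n + k)
  have hmsH₁ : MeasurableSet H₁ := measurableSet_lrCrossing n n
  have hmsH₂ : MeasurableSet H₂ := measurableSet_openCrossing_of_countable _ _ _
  have h12 : (cornerPercolation t).real V * (cornerPercolation t).real H₁ ≤
      (cornerPercolation t).real (V ∩ H₁) :=
    cornerPercolation_real_inter_ge t hupV hupH₁ hmsV hmsH₁
  have h123 : (cornerPercolation t).real (V ∩ H₁) * (cornerPercolation t).real H₂ ≤
      (cornerPercolation t).real (V ∩ H₁ ∩ H₂) :=
    cornerPercolation_real_inter_ge t (hupV.inter hupH₁) hupH₂ (hmsV.inter hmsH₁) hmsH₂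
  have hsub : (cornerPercolation t).real (V ∩ H₁ ∩ H₂) ≤
      (cornerPercolation t).real {ω | ∃ a₁ ∈ leftSide n n, ∃ b₁ ∈ rightSide n n,
          ∃ a₂ ∈ leftSide n n, ∃ b₂ ∈ rightSide n n,
            ω ∈ openConnIn (↑(rectangle n n)) a₁ b₁ ∧
            ω ∈ openConnIn ((· + ![0, (k : ℤ)]) '' ↑(rectangle n n)) (a₂ + ![0, (k : ℤ)])
              (b₂ + ![0, (k : ℤ)]) ∧
            ω ∈ openConnIn (↑(rectangle n (n + k))) a₁ (a₂ + ![0, (k : ℤ)])} := by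
    simp only [measureReal_def]
    refine ENNReal.toReal_mono (measure_ne_top _ _) (measure_mono_ae ?_)
    filter_upwards [cornerPercolation_subset_edgeSet t] with ω hω hmem
    obtain ⟨⟨hV, a₁, ha₁, b₁, hb₁, h₁⟩, x, hx, y, hy, h₂⟩ := hmem
    obtain ⟨a₂, ha₂, rfl⟩ := hx
    obtain ⟨b₂, hb₂, rfl⟩ := hy
    exact ⟨a₁, ha₁, b₁, hb₁, a₂, ha₂, b₂, hb₂, h₁, h₂,
      join_of_tbCrossing hω ha₁ hb₁ ha₂ hb₂ h₁ h₂ hV⟩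
  calc c / 4 = c * (1 / 2) * (1 / 2) := by ring
    _ ≤ (cornerPercolation t).real V * (cornerPercolation t).real H₁ *
          (cornerPercolation t).real H₂ :=
        mul_le_mul (mul_le_mul hc hH₁ (by norm_num) measureReal_nonneg) hH₂ (by norm_num)
          (mul_nonneg measureReal_nonneg measureReal_nonneg)
    _ ≤ (cornerPercolation t).real (V ∩ H₁) * (cornerPercolation t).real H₂ :=
        mul_le_mul_of_nonneg_right h12 measureReal_nonneg
    _ ≤ (cornerPercolation t).real (V ∩ H₁ ∩ H₂) := h123
    _ ≤ _ := hsub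

/-- **The conclusion of `stub_brChain` from a uniform hard-way bound** (Bollobás–Riordan 2010,
Theorem 5.3 in the form `v(n, (1+ε)n) ≥ c`, uniformly in `t`): if there are `c > 0`, `K`, `n₀`
such that for all `t ∈ [0,1]` and `n ≥ n₀` some shift `k` with `1 ≤ k ≤ n`, `n ≤ K k` has
`M_t(TB([0, n] × [0, n + k])) ≥ c`, then the JOIN bound registered as the conclusion of
`stub_brChain` holds with constant `c/4` (`quarter_le_real_join_of_tbCrossing`). Together with the
landed `stub_join` this makes the JOIN item and the hard-way item of line `Sketch` equivalent.
[cite: BollobasRiordan2010, §5.1 Thm. 5.3] -/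
theorem stub_brChain_of_tbBound
    (hV : ∃ c : ℝ, 0 < c ∧ ∃ K n₀ : ℕ, ∀ (t : unitInterval) (n : ℕ), n₀ ≤ n →
      ∃ k : ℕ, 1 ≤ k ∧ k ≤ n ∧ n ≤ K * k ∧ c ≤ (cornerPercolation t).real (tbCrossing n (n + k))) :
    ∃ c : ℝ, 0 < c ∧ ∃ K n₀ : ℕ, ∀ (t : unitInterval) (n : ℕ), n₀ ≤ n →
      ∃ k : ℕ, 1 ≤ k ∧ k ≤ n ∧ n ≤ K * k ∧
        c ≤ (cornerPercolation t).real {ω | ∃ a₁ ∈ leftSide n n, ∃ b₁ ∈ rightSide n n,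
          ∃ a₂ ∈ leftSide n n, ∃ b₂ ∈ rightSide n n,
            ω ∈ openConnIn (↑(rectangle n n)) a₁ b₁ ∧
            ω ∈ openConnIn ((· + ![0, (k : ℤ)]) '' ↑(rectangle n n)) (a₂ + ![0, (k : ℤ)])
              (b₂ + ![0, (k : ℤ)]) ∧
            ω ∈ openConnIn (↑(rectangle n (n + k))) a₁ (a₂ + ![0, (k : ℤ)])} := by
  obtain ⟨c, hc, K, n₀, h⟩ := hV
  refine ⟨c / 4, by positivity, K, n₀, fun t n hn => ?_⟩
  obtain ⟨k, hk1, hkn, hnK, hck⟩ := h t n hn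
  exact ⟨k, hk1, hkn, hnK, quarter_le_real_join_of_tbCrossing t n k hck⟩

end Summit.CriticalPhenomena.CardyFormulaZ2.Cruxes.UniformBoxCrossing.NonSlantLine
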